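import Literature.AnabelianGeometry.SemiGraphs.SemiGraph
import Mathlib.Topology.Bases
import Mathlib.Logic.Relation
import Literature.AnabelianGeometry.SemiGraphs.TemperedGroups
import HarnessLib

/-!
# Semi-graphs of anabelioids, §3 (part 3): `B^cov(G)`, tempered coverings, `B^temp(G)`,
# verticial subgroups, quasi-geometric homomorphisms

Mochizuki, *Semi-graphs of anabelioids*, Publ. RIMS **42** (2006), §3, manuscript pp. 36–42
[cite: MochizukiSemiAnbd2006, §3 pp.36-42].

LOCAL PRESENTATION (`-- TODO-merge: abc-iut-L3-t1`, [SemiAnbd] Def. 2.1 p. 22). The canonical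
semi-graph of anabelioids (`SemiGraphOfAnabelioids`: constituent Galois categories and exact
pull-back functors, §1–2 files) is bridged later; to make the §3 constructions REAL definitions
today this file presents a (countable) semi-graph of anabelioids OVER THE TREE'S `SemiGraph`
(§1 file) by profinite groups — p. 23: "if we choose basepoints for the constituent anabelioids of
`G`, then `G` determines a 'semi-graph of profinite groups'": a vertex group `Π_v` and an edge group
`Π_e` (compact, totally disconnected topological groups, i.e. `G_v = B(Π_v)`, `G_e = B(Π_e)`) and,
for each branch `b` of `e` abutting to `v`, a continuous homomorphism `b_* : Π_e → Π_v` representing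
the outer homomorphism `Π_b → Π_v` (p. 23). The bridge from `SemiGraphOfAnabelioids` (choice of
fibre functors, `Π = Aut F`) is owed to the merge pass with the §2 file.

Typed here, over that presentation:
* `CovObj G` / its category instance = `B^cov(G)` (p. 36): "objects given by data `{S_v, φ_e}`
  where … `S_v ∈ Ob(G_v^⊤)`; for each edge `e`, with branches `b₁, b₂` abutting to vertices
  `v₁, v₂`, respectively, `φ_e : {(b₁)_*}^* S_{v₁} ⥲ {(b₂)_*}^* S_{v₂}` is an isomorphism in `G_e^⊤`,
  and morphisms given by morphisms [in the evident sense] between such data" — rendered in the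
  equivalent edge-object form (an object `S_e ∈ G_e^⊤` for every edge together with gluing
  isomorphisms `S_e ≅ b^* S_v` for every ABUTTING branch; `φ_e` is the composite of the two
  gluings, and edges abutting to `≤ 1` vertex — for which the printed `φ_e` is absent, cf. "if `G`
  has no vertices … `B^cov(G) := G_e^⊤`", p. 37 — need no case distinction). Here `G_v^⊤`, the
  temperification of the connected anabelioid `B(Π_v)`, is `B^temp(Π_v)` (Remark 3.1.4 with
  Remark 3.1.1: a countable discrete continuous `Π_v`-set is a countable coproduct of finite
  transitive ones);
* finite objects (`B(G) ↪ B^cov(G)`, p. 37), Definition 3.5 (i) coverings [= objects], (ii)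
  TEMPERED objects / coverings and `B^temp(G) ⊆ B^cov(G)` (`CovObj.IsTempered`, `BTempCat`) — in
  the form CORRECTED by the author in [IUTchI] Rmk. 2.5.3 (v) p. 55 (temperedness is tested on each
  connected component of the covering; components via `CovObj.SameComponent`), (iii) Galois arrows
  (`IsGaloisArrow`); Galois-countable semi-graphs of anabelioids ([IUTchI] Rmk. 2.5.3 (i) (T2),
  `IsGaloisCountable`) — the hypothesis (E7) of loc. cit. adds to [SemiAnbd] 3.5–3.9;
* the tempered fundamental group `π₁^temp(G)` through its characterisation by Proposition 3.6 (ii)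
  / Remark 3.2.1 — a tempered group `Π` with `B^temp(G) ≌ B^temp(Π)` (`TemperedPiChart`); the
  paper's explicit construction `π₁^temp(G) := lim_i Gal(G_{∞,i}/G)` (p. 38) is recorded in the
  docstring, and its EXISTENCE is Proposition 3.6 (i)–(ii) (companion file `TemperedVerticial.lean`
  with the hypotheses of §2);
* the verticial and edge-like subgroups of Theorem 3.7 (i), (iii) (p. 40–41) as conjugacy classes
  of subgroups of `Π` (`verticialSubgroups`, `edgeLikeSubgroups`), defined through the restriction
  functors `B^temp(G) ⥤ B^temp(Π_v)` and Proposition 3.2;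
* (Definition 3.8 quasi-geometric homomorphisms and Remark 3.8.1: companion file
  `TemperedQuasiGeometric.lean`.)

Deliberately NOT here: Remark 3.5.1 (locally trivial coverings ↔ graph-coverings with countable
fibres), Remark 3.5.2, Proposition 3.6, the claims of Theorem 3.7 (i)–(iv), Corollary 3.9,
Remark 3.9.1 — the statements needing the §2 hypotheses (quasi-coherent, totally elevated / aloof / estranged,
verticially slim, locally open morphisms): companion file `TemperedVerticial.lean`. No statement
of the paper is strengthened.
-/

open CategoryTheory Topology

namespace Literature.AnabelianGeometry.SemiGraphs

open Literature.AlgebraicGeometry.Frobenioids (IsConnectedObj)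

universe u

/-! ### The local presentation of a semi-graph of anabelioids (TODO-merge: abc-iut-L3-t1) -/

/-- LOCAL PRESENTATION of a semi-graph of anabelioids ([SemiAnbd] Def. 2.1 p. 22 with p. 23 "semi-graph
of profinite groups"; TODO-merge abc-iut-L3-t1 `SemiGraphOfAnabelioids`): an underlying semi-graph
(the §1 file's `SemiGraph`: vertices, edges, branches with `abuts b = none` for "abuts to no
vertex"), profinite vertex and edge groups `Π_v`, `Π_e`, and for every branch `b` of `e` abutting
to `v` a continuous homomorphism `b_* : Π_e → Π_v`. [cite: MochizukiSemiAnbd2006, Def 2.1 p.22] -/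
structure ProfiniteSemiGraph : Type (u + 1) where
  /-- the underlying semi-graph -/
  graph : SemiGraph.{u}
  /-- the vertex groups `Π_v = π̂₁(G_v)` -/
  Gv : graph.Vertex → Type u
  /-- the edge groups `Π_e = π̂₁(G_e)` -/
  Ge : graph.Edge → Type u
  [groupV : ∀ v, Group (Gv v)]
  [topologicalSpaceV : ∀ v, TopologicalSpace (Gv v)]
  [isTopologicalGroupV : ∀ v, IsTopologicalGroup (Gv v)]
  [compactSpaceV : ∀ v, CompactSpace (Gv v)]
  [totallyDisconnectedSpaceV : ∀ v, TotallyDisconnectedSpace (Gv v)]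
  [groupE : ∀ e, Group (Ge e)]
  [topologicalSpaceE : ∀ e, TopologicalSpace (Ge e)]
  [isTopologicalGroupE : ∀ e, IsTopologicalGroup (Ge e)]
  [compactSpaceE : ∀ e, CompactSpace (Ge e)]
  [totallyDisconnectedSpaceE : ∀ e, TotallyDisconnectedSpace (Ge e)]
  /-- `b_* : Π_e → Π_v` for the branch `b` of `e` abutting to `v` -/
  brHom : ∀ (b : graph.Branch) (v : graph.Vertex), graph.abuts b = some v →
    (Ge (graph.edgeOf b) →ₜ* Gv v)

namespace ProfiniteSemiGraph

attribute [instance] groupV topologicalSpaceV isTopologicalGroupV compactSpaceV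
  totallyDisconnectedSpaceV groupE topologicalSpaceE isTopologicalGroupE compactSpaceE
  totallyDisconnectedSpaceE

variable (𝒢 : ProfiniteSemiGraph.{u})

/-- `G` is *countable*: its underlying semi-graph is (§1 p. 11; the standing assumption of §3, p. 36
"Let `G` be a connected, countable … semi-graph of anabelioids"). [cite: MochizukiSemiAnbd2006, §1 p.11] -/
abbrev IsCountable : Prop := 𝒢.graph.IsCountable

/-- The image `Π_b ⊆ Π_v` of the edge group along an abutting branch `b` (p. 23: "we shall also
denote the image of `Π_b` in `Π_v`, which is well-defined up to conjugation in `Π_v`, by `Π_b`").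
[cite: MochizukiSemiAnbd2006, §2 p.23] -/
def branchSubgroup (b : 𝒢.graph.Branch) (v : 𝒢.graph.Vertex) (h : 𝒢.graph.abuts b = some v) :
    Subgroup (𝒢.Gv v) :=
  (𝒢.brHom b v h).toMonoidHom.range

/-! ### `B^cov(G)` (p. 36) -/

/-- An object of `B^cov(G)` ([SemiAnbd] §3 p. 36): a countable discrete continuous `Π_v`-set `S_v` for
every vertex, a countable discrete continuous `Π_e`-set `S_e` for every edge, and for every branch
`b = (e, i)` abutting to `v` a gluing isomorphism `S_e ≅ b^* S_v` of `Π_e`-sets (edge-object form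
of the printed data `{S_v, φ_e}`, see the module docstring). These objects ARE the "coverings of
semi-graphs of anabelioids `G' → G`" of Definition 3.5 (i) (p. 37).
[cite: MochizukiSemiAnbd2006, §3 p.36] -/
structure CovObj : Type (u + 1) where
  /-- the `Π_v`-sets `S_v ∈ G_v^⊤ = B^temp(Π_v)` -/
  SV : ∀ v : 𝒢.graph.Vertex, BTemp (𝒢.Gv v)
  /-- the `Π_e`-sets `S_e ∈ G_e^⊤ = B^temp(Π_e)` -/
  SE : ∀ e : 𝒢.graph.Edge, BTemp (𝒢.Ge e)
  /-- the gluing `S_e ≅ b^* S_v` along an abutting branch -/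
  glue : ∀ (b : 𝒢.graph.Branch) (v : 𝒢.graph.Vertex) (h : 𝒢.graph.abuts b = some v),
    SE (𝒢.graph.edgeOf b) ≅ (BTemp.res (𝒢.brHom b v h)).obj (SV v)

variable {𝒢}

/-- A morphism of `B^cov(G)` ([SemiAnbd] §3 p. 36: "morphisms [in the evident sense] between such
data"): `Π_v`-maps and `Π_e`-maps compatible with the gluings.
[cite: MochizukiSemiAnbd2006, §3 p.36] -/
@[ext] structure CovHom (S T : CovObj 𝒢) : Type u where
  /-- the components at vertices -/
  fV : ∀ v : 𝒢.graph.Vertex, S.SV v ⟶ T.SV v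
  /-- the components at edges -/
  fE : ∀ e : 𝒢.graph.Edge, S.SE e ⟶ T.SE e
  /-- compatibility with the gluing isomorphisms -/
  comm : ∀ (b : 𝒢.graph.Branch) (v : 𝒢.graph.Vertex) (h : 𝒢.graph.abuts b = some v),
    fE (𝒢.graph.edgeOf b) ≫ (T.glue b v h).hom =
      (S.glue b v h).hom ≫ (BTemp.res (𝒢.brHom b v h)).map (fV v)

/-- `B^cov(G)` is a category ([SemiAnbd] §3 p. 36). [cite: MochizukiSemiAnbd2006, §3 p.36] -/
instance : Category (CovObj 𝒢) where
  Hom := CovHom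
  id S := ⟨fun _ => 𝟙 _, fun _ => 𝟙 _, fun b v h => by simp⟩
  comp f g := ⟨fun v => f.fV v ≫ g.fV v, fun e => f.fE e ≫ g.fE e, fun b v h => by
    rw [Category.assoc, g.comm, ← Category.assoc, f.comm, Category.assoc, Functor.map_comp]⟩
  id_comp f := by ext <;> simp
  comp_id f := by ext <;> simp
  assoc f g h := by ext <;> simp

/-- Vertex components of identities. [cite: MochizukiSemiAnbd2006, §3 p.36] -/
@[simp] theorem CovHom.id_fV (S : CovObj 𝒢) (v : 𝒢.graph.Vertex) :
    (𝟙 S : CovHom S S).fV v = 𝟙 _ := rfl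

/-- Edge components of identities. [cite: MochizukiSemiAnbd2006, §3 p.36] -/
@[simp] theorem CovHom.id_fE (S : CovObj 𝒢) (e : 𝒢.graph.Edge) :
    (𝟙 S : CovHom S S).fE e = 𝟙 _ := rfl

/-- Vertex components of composites. [cite: MochizukiSemiAnbd2006, §3 p.36] -/
@[simp] theorem CovHom.comp_fV {S T U : CovObj 𝒢} (f : S ⟶ T) (g : T ⟶ U) (v : 𝒢.graph.Vertex) :
    (f ≫ g).fV v = f.fV v ≫ g.fV v := rfl

/-- Edge components of composites. [cite: MochizukiSemiAnbd2006, §3 p.36] -/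
@[simp] theorem CovHom.comp_fE {S T U : CovObj 𝒢} (f : S ⟶ T) (g : T ⟶ U) (e : 𝒢.graph.Edge) :
    (f ≫ g).fE e = f.fE e ≫ g.fE e := rfl

variable (𝒢)

/-- The restriction functor `B^cov(G) ⥤ G_v^⊤ = B^temp(Π_v)`, `S ↦ S_v` ("the restriction of `G' → G`
to `G_v`", Def. 3.5 (ii) p. 37). [cite: MochizukiSemiAnbd2006, Def 3.5(ii) p.37] -/
def restrictV (v : 𝒢.graph.Vertex) : CovObj 𝒢 ⥤ BTemp (𝒢.Gv v) where
  obj S := S.SV v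
  map f := f.fV v

/-- The restriction functor `B^cov(G) ⥤ G_e^⊤ = B^temp(Π_e)`, `S ↦ S_e`.
[cite: MochizukiSemiAnbd2006, Def 3.5(ii) p.37] -/
def restrictE (e : 𝒢.graph.Edge) : CovObj 𝒢 ⥤ BTemp (𝒢.Ge e) where
  obj S := S.SE e
  map f := f.fE e

variable {𝒢}

/-- *Finite* objects of `B^cov(G)` ([SemiAnbd] §3 p. 37: "we have a natural full embedding
`B(G) ↪ B^cov(G)`. An object of `B^cov(G)` that lies in the essential image of `B(G)` will be called
finite"): all the sets `S_v`, `S_e` are finite. (The canonical `B(G)` is the §2 file's; TODO-merge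
abc-iut-L3-t1.) [cite: MochizukiSemiAnbd2006, §3 p.37] -/
@[mk_iff] structure CovObj.IsFinite (S : CovObj 𝒢) : Prop where
  /-- finite vertex fibres -/
  finite_V : ∀ v, Finite (S.SV v).obj.V
  /-- finite edge fibres -/
  finite_E : ∀ e, Finite (S.SE e).obj.V

/-- An object of `B^cov(G)` with all fibres nonempty (a covering `G' → G` surjective over every
component; automatic for nonempty objects when `G` is connected). [cite: MochizukiSemiAnbd2006, §3 p.37] -/
@[mk_iff] structure CovObj.HasNonemptyFibres (S : CovObj 𝒢) : Prop where
  /-- nonempty vertex fibres -/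
  nonempty_V : ∀ v, Nonempty (S.SV v).obj.V
  /-- nonempty edge fibres -/
  nonempty_E : ∀ e, Nonempty (S.SE e).obj.V

/-- `F` *splits* `S` over every constituent anabelioid: over each component `c`, the stabiliser in
`Π_c` of every point of `F_c` acts trivially on `S_c` — i.e. the base change of the covering `S_c`
of `G_c` to each connected component `Π_c/Stab(x)` of `F_c` is a trivial covering ("the
restriction of `G'' → G` to `G_c` splits the restriction of `G' → G` to `G_c`", Def. 3.5 (ii) p. 37;
also the splitting condition of [IUTchI] Rmk. 2.5.3 (i) (T2)). [cite: MochizukiSemiAnbd2006, Def 3.5(ii) p.37] -/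
def CovObj.Splits (F S : CovObj 𝒢) : Prop :=
  (∀ (v : 𝒢.graph.Vertex) (x : (F.SV v).obj.V) (g : 𝒢.Gv v), (F.SV v).obj.ρ g x = x →
      ∀ s : (S.SV v).obj.V, (S.SV v).obj.ρ g s = s) ∧
    ∀ (e : 𝒢.graph.Edge) (x : (F.SE e).obj.V) (g : 𝒢.Ge e), (F.SE e).obj.ρ g x = x →
      ∀ s : (S.SE e).obj.V, (S.SE e).obj.ρ g s = s

/-- The points of an object `S` of `B^cov(G)`: the disjoint union of all the fibres `S_v`, `S_e`
(used to speak of the connected components of the covering `G' → G`).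
[cite: MochizukiSemiAnbd2006, Def 3.5(ii) p.37] -/
def CovObj.Point (S : CovObj 𝒢) : Type u :=
  (Σ v : 𝒢.graph.Vertex, (S.SV v).obj.V) ⊕ (Σ e : 𝒢.graph.Edge, (S.SE e).obj.V)

/-- The relation generating the connected components of `S`: two points of one fibre in the same
orbit, or a point of `S_e` and its image in `S_v` under the gluing along a branch of `e` abutting to
`v`. [cite: MochizukiSemiAnbd2006, Def 3.5(ii) p.37] -/
inductive CovObj.Adj (S : CovObj 𝒢) : S.Point → S.Point → Prop
  | vertex (v : 𝒢.graph.Vertex) (g : 𝒢.Gv v) (x : (S.SV v).obj.V) :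
      CovObj.Adj S (Sum.inl ⟨v, x⟩) (Sum.inl ⟨v, (S.SV v).obj.ρ g x⟩)
  | edge (e : 𝒢.graph.Edge) (g : 𝒢.Ge e) (x : (S.SE e).obj.V) :
      CovObj.Adj S (Sum.inr ⟨e, x⟩) (Sum.inr ⟨e, (S.SE e).obj.ρ g x⟩)
  | glue (b : 𝒢.graph.Branch) (v : 𝒢.graph.Vertex) (h : 𝒢.graph.abuts b = some v)
      (x : (S.SE (𝒢.graph.edgeOf b)).obj.V) :
      CovObj.Adj S (Sum.inr ⟨𝒢.graph.edgeOf b, x⟩) (Sum.inl ⟨v, (S.glue b v h).hom.hom.hom x⟩)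

/-- Two points of `S` lie in the same *connected component* of the covering `G' → G` determined by
`S`: the equivalence relation generated by `CovObj.Adj`. [cite: MochizukiSemiAnbd2006, Def 3.5(ii) p.37] -/
def CovObj.SameComponent (S : CovObj 𝒢) : S.Point → S.Point → Prop := Relation.EqvGen S.Adj

/-- `F` *splits* `S` *at the point* `q`: the stabilisers of the points of the fibre of `F` over the
component of `G` under `q` fix `q`. [cite: MochizukiSemiAnbd2006, Def 3.5(ii) p.37] -/
def CovObj.SplitsAt (F S : CovObj 𝒢) : S.Point → Prop
  | Sum.inl ⟨v, s⟩ => ∀ (x : (F.SV v).obj.V) (g : 𝒢.Gv v), (F.SV v).obj.ρ g x = x →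
      (S.SV v).obj.ρ g s = s
  | Sum.inr ⟨e, s⟩ => ∀ (x : (F.SE e).obj.V) (g : 𝒢.Ge e), (F.SE e).obj.ρ g x = x →
      (S.SE e).obj.ρ g s = s

/-- **Definition 3.5 (ii)** ([SemiAnbd] §3 p. 37, with the author's correction [IUTchI] Rmk. 2.5.3
(v) p. 55: "the phrase 'Suppose that' should read 'Suppose that each connected component of'; the
phrase 'splits the restriction of' should read 'splits the restriction of this connected component
of'"): a covering `G' → G` [an object `S` of `B^cov(G)`] is *tempered* if for each connected
component of `G'` "there exists a finite étale covering `G'' → G` with the property that, for any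
component [i.e., vertex or edge] `c` of `G`, the restriction of `G'' → G` to `G_c` splits the
restriction of [this connected component of] `G' → G` to `G_c`" — every point `p` of `S` admits a
finite object `F` with nonempty fibres splitting `S` at every point of the component of `p`.
[cite: MochizukiSemiAnbd2006, Def 3.5(ii) p.37] -/
def CovObj.IsTempered (S : CovObj 𝒢) : Prop :=
  ∀ p : S.Point, ∃ F : CovObj 𝒢, F.IsFinite ∧ F.HasNonemptyFibres ∧
    ∀ q : S.Point, S.SameComponent p q → F.SplitsAt S q

variable (𝒢) in
/-- **Definition 3.5 (ii)** ([SemiAnbd] §3 p. 37): "`B^temp(G) ⊆ B^cov(G)`, the full subcategory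
determined by the tempered objects." [cite: MochizukiSemiAnbd2006, Def 3.5(ii) p.37] -/
abbrev BTempCat := ObjectProperty.FullSubcategory fun S : CovObj 𝒢 => S.IsTempered

variable (𝒢) in
/-- `B(G) ↪ B^temp(G)`: the full subcategory of `B^cov(G)` on the finite objects (p. 37: "we have
natural full embeddings `B(G) ↪ B^temp(G) ↪ B^cov(G)`"; local stand-in for the §2 file's `B(G)`,
TODO-merge abc-iut-L3-t1). [cite: MochizukiSemiAnbd2006, Def 3.5(ii) p.37] -/
abbrev BFinCat := ObjectProperty.FullSubcategory fun S : CovObj 𝒢 => S.IsFinite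

variable (𝒢) in
/-- `G` is *Galois-countable* ([IUTchI] Rmk. 2.5.3 (i) (T2) p. 52, the author's erratum to [SemiAnbd]
§3): "countable, and, moreover, admits a countable collection of finite étale coverings
`{G_i → G}_{i ∈ I}` such that for any finite étale covering `H → G`, there exists an `i ∈ I` such that
the base-changed covering `H ×_G G_i → G_i` splits over the constituent anabelioid associated to each
component of `G_i`" — i.e. `G_i` splits `H` over every constituent anabelioid (`CovObj.Splits`). By
(E7) of loc. cit. this hypothesis must be added in [SemiAnbd] 3.5–3.9.
[cite: Mochizuki2012, IUTchI Rmk 2.5.3 (i) (T2), p. 52] -/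
def IsGaloisCountable : Prop :=
  𝒢.IsCountable ∧ ∃ F : ℕ → CovObj 𝒢, (∀ i, (F i).IsFinite ∧ (F i).HasNonemptyFibres) ∧
    ∀ H : CovObj 𝒢, H.IsFinite → ∃ i, (F i).Splits H

/-- "coverings of semi-graphs of anabelioids that arise from finite objects of `B^cov(G)` determine
'finite étale coverings'" and "`B(G) ↪ B^temp(G)`" (Def. 3.5 (i)–(ii) p. 37), named fact: for `G`
connected and countable, a finite object is tempered (each of its components is split by a Galois
finite étale covering dominating it). [cite: MochizukiSemiAnbd2006, Def 3.5(ii) p.37] -/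
def FiniteIsTempered : Prop :=
  ∀ (𝒢 : ProfiniteSemiGraph.{u}), 𝒢.graph.IsConnected → 𝒢.IsCountable →
    ∀ (S : CovObj 𝒢), S.IsFinite → S.IsTempered

/-- **Definition 3.5 (iii)** ([SemiAnbd] §3 p. 37): "An arrow `φ : H₁ → H₂` of `B^cov(G)` with
connected domain and codomain will be called *Galois* if, for any two arrows `ψ₁, ψ₂ : K → H₁` such
that `φ ∘ ψ₁ = φ ∘ ψ₂`, there exists a [unique] automorphism `α ∈ Aut_{H₂}(H₁)` of `H₁` over `H₂`
such that `ψ₁ = α ∘ ψ₂`." ("connected" in the sense of the §0 dictionary.)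
[cite: MochizukiSemiAnbd2006, Def 3.5(iii) p.37] -/
def IsGaloisArrow {H₁ H₂ : CovObj 𝒢} (φ : H₁ ⟶ H₂) : Prop :=
  IsConnectedObj H₁ ∧ IsConnectedObj H₂ ∧
    ∀ (K : CovObj 𝒢) (ψ₁ ψ₂ : K ⟶ H₁), ψ₁ ≫ φ = ψ₂ ≫ φ →
      ∃ α : Aut H₁, α.hom ≫ φ = φ ∧ ψ₁ = ψ₂ ≫ α.hom

/-! ### The tempered fundamental group `π₁^temp(G)` (pp. 38) -/

variable (𝒢)

/-- A *tempered fundamental group* of `G` ([SemiAnbd] §3 p. 38 with Prop. 3.6 (ii) and Remark 3.2.1):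
a tempered topological group `Π` together with an equivalence `B^temp(G) ≌ B^temp(Π)`. The paper
CONSTRUCTS one — "`π₁^temp(G) := lim_i Gal(G_{∞,i}/G)`" over a cofinal system of connected finite
étale Galois coverings `G_i → G` with `G_{∞,i}` the covering of `G_i` "determined by the universal
graph-covering of the underlying semi-graph" (p. 38), "independent, up to inner automorphism, of
the choice" — and Proposition 3.6 (ii) identifies `B^temp(π₁^temp(G)) ⥲ B^temp(G)`; by
Proposition 3.2 any two charts have conjugate-isomorphic groups. Existence of a chart under the
§2 hypotheses is Proposition 3.6 (i)–(ii) (companion file). [cite: MochizukiSemiAnbd2006, Prop 3.6(ii) p.38] -/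
structure TemperedPiChart : Type (u + 1) where
  /-- the underlying type of `π₁^temp(G)` -/
  G : Type u
  [group : Group G]
  [topologicalSpace : TopologicalSpace G]
  [isTopologicalGroup : IsTopologicalGroup G]
  /-- Prop. 3.6 (i): "`π₁^temp(G)` … is tempered" -/
  isTempered : Literature.AnabelianGeometry.SemiGraphs.IsTempered G
  /-- `π₁^temp(G)` is Galois-countable ([IUTchI] Rmk. 2.5.3 (i) (T6) p. 53: for `G` Galois-countable
  "`π₁^temp(G)` and … `B^temp(G)` are well-defined and Galois-countable") -/
  secondCountableTopology : SecondCountableTopology G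
  /-- Prop. 3.6 (ii): "`B^temp(π₁^temp(G)) ⥲ B^temp(G)`" -/
  equiv : BTempCat 𝒢 ≌ BTemp G

attribute [instance] TemperedPiChart.group TemperedPiChart.topologicalSpace
  TemperedPiChart.isTopologicalGroup

variable {𝒢}

/-- **Theorem 3.7 (i)** vocabulary ([SemiAnbd] §3 p. 40): the *verticial subgroups* of `π₁^temp(G)`
attached to the vertex `v` — the images of the "natural continuous … outer homomorphism
`π̂₁(G_v) → π₁^temp(G)`", i.e. (Proposition 3.2) of the continuous homomorphisms `φ : Π_v → Π` whose
pull-back functor `B^temp(φ)` is isomorphic to the restriction `B^temp(G) → G_v^⊤`, `S ↦ S_v`,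
transported along the chart. "By abuse of notation, we shall write `π̂₁(G_v)` for the subgroup
[well-defined up to conjugation] determined by the image of this homomorphism. We shall refer to
the … subgroups … that arise in this way as the verticial subgroups."
[cite: MochizukiSemiAnbd2006, Thm 3.7(i) p.40] -/
def verticialSubgroups (c : TemperedPiChart 𝒢) (v : 𝒢.graph.Vertex) : Set (Subgroup c.G) :=
  {H | ∃ φ : 𝒢.Gv v →ₜ* c.G,
    Nonempty (c.equiv.inverse ⋙ ObjectProperty.ι _ ⋙ restrictV 𝒢 v ≅ BTemp.res φ) ∧
      H = φ.toMonoidHom.range}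

/-- **Theorem 3.7 (iii)** vocabulary ([SemiAnbd] §3 p. 41): the *edge-like subgroups* of
`π₁^temp(G)` — "such images of '`π̂₁(G_e)`'s" — defined like the verticial ones through the
restriction `B^temp(G) → G_e^⊤`, `S ↦ S_e`. [cite: MochizukiSemiAnbd2006, Thm 3.7(iii) p.41] -/
def edgeLikeSubgroups (c : TemperedPiChart 𝒢) (e : 𝒢.graph.Edge) : Set (Subgroup c.G) :=
  {H | ∃ φ : 𝒢.Ge e →ₜ* c.G,
    Nonempty (c.equiv.inverse ⋙ ObjectProperty.ι _ ⋙ restrictE 𝒢 e ≅ BTemp.res φ) ∧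
      H = φ.toMonoidHom.range}

end ProfiniteSemiGraph

end Literature.AnabelianGeometry.SemiGraphs
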